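import Mathlib
import Summits.Ventures.PercRepro2.Defs
import Summits.Ventures.PercRepro2.Graph
import Summits.Ventures.PercRepro2.OneColourSwitch
import Summits.Ventures.PercRepro2.RegionHubSign
import Summits.Ventures.PercRepro2.SideSwitch
import Summits.Ventures.PercRepro2.SideSwitchFibre
import Summits.Ventures.PercRepro2.SideSwitchComps
import Summits.Ventures.PercRepro2.M9NoPocketDefs
import Summits.Ventures.PercRepro2.M9NoPocketWorld
import Summits.Ventures.PercRepro2.M9NoPocketWorldD
import Summits.Ventures.PercRepro2.M9NoPocketLegal
import Summits.Ventures.PercRepro2.M9NoPocketFibre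
import Summits.Ventures.PercRepro2.M9NoPocketCompl
import Summits.Ventures.PercRepro2.M9NoPocketFreeBlock
import Summits.Ventures.PercRepro2.M9NoPocketFreeBlockK
import Summits.Ventures.PercRepro2.M9NoPocketDirty
import Summits.Ventures.PercRepro2.M9NoPocketHDR
import Summits.Ventures.PercRepro2.M9GeneralDSplit
import Summits.Ventures.PercRepro2.M9FourParts
import Summits.Ventures.PercRepro2.M9TwoExHd
import Summits.Ventures.PercRepro2.M9QuadHarrisPow
import Summits.Ventures.PercRepro2.M9QuadHarrisTwoPow
import Summits.Ventures.PercRepro2.M9UnitAlgebra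
import Summits.Ventures.PercRepro2.M9NoPocketSameType
import Summits.Ventures.PercRepro2.M9NoPocketDeadPattern
import Summits.Ventures.PercRepro2.M9NoPocketLinkCompl
import Summits.Ventures.PercRepro2.M9NoPocketLinkE
import Summits.Ventures.PercRepro2.M9NoPocketSigmaRS
import Summits.Ventures.PercRepro2.M9NoPocketUnitE
import Summits.Ventures.PercRepro2.M9NoPocketUnitK
import Summits.Ventures.PercRepro2.M9NoPocketUnitK2
import Summits.Ventures.PercRepro2.M9NoPocketUnitSum
import Summits.Ventures.PercRepro2.M9NoPocketRK
import Summits.Ventures.PercRepro2.M9NoPocketUnitMono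
import Summits.Ventures.PercRepro2.M9NoPocketDeadLegal
import Summits.Ventures.PercRepro2.M9NoPocketGoodEdge
import Summits.Ventures.PercRepro2.M9NoPocketGoodCount
import Summits.Ventures.PercRepro2.M9NoPocketDirtySum

/-!
# THEOREM 2EXHD-NP: the sharpened crux `2·exSum + hdSum ≤ 0` on the no-pocket class (blind
cell PercRepro2, p3 g36, 2026-08-29; `proofs/P3-NPHDR.md` §5′, kernel)

On the class `{NoPocketAt d, T-free, no loop at d, no r–s edge}` the sharpened crux ⟦2EXHD⟧
holds (`two_ex_add_hd_nonpos_of_noPocket`): `exSum` is the sum over the same-type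
representatives of the doubly-reached part `EX` (`exSum_eq_sum_EX`), `hdSum` is the sum over
them of `Σ_{∅ ≠ D ≠ A} [K(ρ₀, D) + K(ρ₁, D)]` (`hdSum_eq_sum_K`, the `M`-points being the
`K`-points of the outside flip), the doubling pairs `EX(ρ₀)` with `EX(ρ₁)`, and the unit
inequality of the dirty part (`unit_two_ex_hd_nonpos`) is the 2EXHD quad inequality with the
counting hypothesis `two_le_sum_linkK`.  Consequences (`M9TwoExHd`): ⟦EXHD⟧ when `EX ≥ 0`,
`3·EX + 2·kOnly ≤ 0`, and `dSignSum ≤ 0` once more.  Own work; std axioms.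
-/

namespace Summit.Ventures.PercRepro2

namespace NoPocket

open Finset Classical RegionHub OneColourSwitch SideSwitch M9Reduce

variable {V : Type*} {E : Type*}

section TwoEXHD

variable [Fintype V] [DecidableEq V] [Fintype E] [DecidableEq E] {ends : E → Sym2 V}

omit [DecidableEq E] in
/-- The joined blocks are non-empty when `d` has an edge. -/
lemma joined_ne_empty {d r s : V} (hnp : NoPocketAt ends d r s) (hr : d ≠ r) (hs : d ≠ s)
    (hT : Tset ends d r s = ∅) (hloop : ∀ e, ends e ≠ s(d, d)) {ρ₀ : Config E}
    (hst : ∀ e, d ∈ ends e → ρ₀ e = true) (hA : univ.filter (fun e => d ∈ ends e) ≠ ∅) :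
    (blocks ends d r s ρ₀).filter (hasY ends d ρ₀) ≠ ∅ := by
  obtain ⟨e, he⟩ := Finset.nonempty_iff_ne_empty.2 hA
  obtain ⟨C, hC, y, hyC, hends⟩ :=
    exists_block_of_edge_at_d hnp hr hs hT hloop ρ₀ (Finset.mem_filter.1 he).2
  intro h0
  have : C ∈ (blocks ends d r s ρ₀).filter (hasY ends d ρ₀) :=
    Finset.mem_filter.2 ⟨hC, (hasY_sameType_iff hst C).2 ⟨e, y, hyC, hends⟩⟩
  rw [h0] at this
  exact Finset.notMem_empty C this

/-- **The hub–dead-end sum of the unit of a same-type representative**: the `K`-points of the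
proper patterns of `ρ₀` and of its outside flip. -/
theorem sum_hd_sameType_eq {p q r s d : V} (hnp : NoPocketAt ends d r s) (hr : d ≠ r)
    (hs : d ≠ s) (hT : Tset ends d r s = ∅) (hloop : ∀ e, ends e ≠ s(d, d))
    (hrs : ∀ e, ends e ≠ s(r, s)) {ρ₀ : Config E} (hρ₀ : ρ₀ ∈ RepD ends p q r s d)
    (hst : ∀ e, d ∈ ends e → ρ₀ e = true) {𝔉 𝔑 : Finset (Finset V)}
    (h𝔉 : 𝔉 = (blocks ends d r s ρ₀).filter (fun C => ¬ hasY ends d ρ₀ C))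
    (h𝔑 : 𝔑 = (blocks ends d r s ρ₀).filter (hasY ends d ρ₀)) :
    ∑ D ∈ (univ.filter (fun e => d ∈ ends e)).powerset,
      (if hasDead ends d r s (flipF D ρ₀) ∧ hasSource ends d r s (flipF D ρ₀) then
        ∑ x ∈ L4 ends d r s (flipF D ρ₀),
          sigma ends (assignX ends x (flipF D ρ₀)) p q *
            sigma ends (assignX ends x (flipF D ρ₀)) r s
      else 0) =
      ∑ D ∈ (univ.filter (fun e => d ∈ ends e)).powerset.filter
          (fun D => D ≠ ∅ ∧ D ≠ univ.filter (fun e => d ∈ ends e)),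
        ((∑ T ∈ 𝔉.powerset, sigma ends (assignX ends (T, ∅) (flipF D ρ₀)) p q *
            sigma ends (assignX ends (T, ∅) (flipF D ρ₀)) r s) +
          (∑ T ∈ 𝔉.powerset,
            sigma ends (assignX ends (T, ∅) (flipF D (flipOp ends d r s ρ₀))) p q *
              sigma ends (assignX ends (T, ∅) (flipF D (flipOp ends d r s ρ₀))) r s)) := by
  -- the condition is `D ≠ ∅ ∧ D ≠ A`
  have hcond : ∀ D ∈ (univ.filter (fun e => d ∈ ends e)).powerset,
      (hasDead ends d r s (flipF D ρ₀) ∧ hasSource ends d r s (flipF D ρ₀)) ↔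
        (D ≠ ∅ ∧ D ≠ univ.filter (fun e => d ∈ ends e)) := by
    intro D hD
    have hD' := Finset.mem_powerset.1 hD
    rw [hasDead_flipF_iff hnp hr hs hT hloop hst (fun e he => (Finset.mem_filter.1 (hD' he)).2),
      hasSource_flipF_iff hnp hr hs hT hloop hst hD']
  rw [Finset.sum_congr rfl (fun D hD => by rw [if_congr (hcond D hD) rfl rfl]),
    ← Finset.sum_filter]
  refine Finset.sum_congr rfl (fun D hD => ?_)
  obtain ⟨hDp, hD0, hDA⟩ := Finset.mem_filter.1 hD
  have hD' := Finset.mem_powerset.1 hDp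
  have hDd : ∀ e ∈ D, d ∈ ends e := fun e he => (Finset.mem_filter.1 (hD' he)).2
  have hA : univ.filter (fun e => d ∈ ends e) ≠ ∅ := by
    intro h
    rw [h, Finset.subset_empty] at hD'
    exact hD0 hD'
  have h𝔑0 : 𝔑 ≠ ∅ := by rw [h𝔑]; exact joined_ne_empty hnp hr hs hT hloop hst hA
  rw [sum_L4_flipF_eq hnp hr hs hT hloop hst hD' hD0 hDA h𝔉 h𝔑 h𝔑0]
  congr 1
  -- the `M`-points are the `K`-points of the outside flip, reindexed by `T ↦ 𝔉 ∖ T`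
  rw [Finset.sum_congr rfl (fun T hTp =>
    sigma_mul_M_eq_K_flipOp hnp hr hs hT hrs hρ₀ hDd h𝔉 h𝔑 (Finset.mem_powerset.1 hTp))]
  refine Finset.sum_nbij' (fun T => 𝔉 \ T) (fun T => 𝔉 \ T)
    (fun T _ => Finset.mem_powerset.2 Finset.sdiff_subset)
    (fun T _ => Finset.mem_powerset.2 Finset.sdiff_subset)
    (fun T hT => Finset.sdiff_sdiff_eq_self (Finset.mem_powerset.1 hT))
    (fun T hT => Finset.sdiff_sdiff_eq_self (Finset.mem_powerset.1 hT)) (fun T _ => rfl)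

/-- **The doubly-reached sum of the unit of a same-type representative** is its `EX`. -/
theorem sum_ex_sameType_all {p q r s d : V} (hnp : NoPocketAt ends d r s) (hr : d ≠ r)
    (hs : d ≠ s) (hT : Tset ends d r s = ∅) (hloop : ∀ e, ends e ≠ s(d, d)) {ρ₀ : Config E}
    (hρ₀ : ρ₀ ∈ RepD ends p q r s d) (hst : ∀ e, d ∈ ends e → ρ₀ e = true)
    {𝔉 𝔑 : Finset (Finset V)}
    (h𝔉 : 𝔉 = (blocks ends d r s ρ₀).filter (fun C => ¬ hasY ends d ρ₀ C))
    (h𝔑 : 𝔑 = (blocks ends d r s ρ₀).filter (hasY ends d ρ₀)) :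
    ∑ D ∈ (univ.filter (fun e => d ∈ ends e)).powerset, ∑ x ∈ L4 ends d r s (flipF D ρ₀),
      (if d ∈ K2 ends r s (assignX ends x (flipF D ρ₀)) ∧
          d ∈ M2 ends r s (assignX ends x (flipF D ρ₀)) then
        sigma ends (assignX ends x (flipF D ρ₀)) p q * sigma ends (assignX ends x (flipF D ρ₀)) r s
      else 0) =
      ∑ T ∈ 𝔉.powerset, ∑ S ∈ 𝔑.powerset.filter (fun S => S ≠ ∅ ∧ S ≠ 𝔑),
        sigma ends (assignX ends (T ∪ S, ∅) ρ₀) p q * sigma ends (assignX ends (T ∪ S, ∅) ρ₀) r s := by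
  rw [Finset.sum_eq_single (∅ : Finset E)]
  · rw [flipF_empty]
    exact sum_ex_sameType_eq hnp hr hs hT hρ₀ hst h𝔉 h𝔑
  · intro D hD hD0
    have hDd : ∀ e ∈ D, d ∈ ends e :=
      fun e he => (Finset.mem_filter.1 (Finset.mem_powerset.1 hD he)).2
    refine Finset.sum_eq_zero (fun x hx => ?_)
    rw [if_neg (not_both_of_flipF hnp hr hs hT hloop hρ₀ hst hDd hD0 hx)]
  · intro h
    exact absurd (Finset.mem_powerset.2 (Finset.empty_subset _)) h

/-- **The unit inequality of the dirty part**: the doubly-reached points and the dirty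
`K`-points of a same-type representative and of its outside flip add up to `≤ 0`. -/
theorem unit_two_ex_hd_nonpos {p q r s d : V} (hnp : NoPocketAt ends d r s) (hpd : p ≠ d)
    (hqd : q ≠ d) (hr : d ≠ r) (hs : d ≠ s) (hT : Tset ends d r s = ∅)
    (hloop : ∀ e, ends e ≠ s(d, d)) (hrs : ∀ e, ends e ≠ s(r, s)) (hrs' : r ≠ s)
    {ρ₀ : Config E} (hρ₀ : ρ₀ ∈ RepD ends p q r s d) (hst : ∀ e, d ∈ ends e → ρ₀ e = true)
    {𝔉 𝔑 : Finset (Finset V)}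
    (h𝔉 : 𝔉 = (blocks ends d r s ρ₀).filter (fun C => ¬ hasY ends d ρ₀ C))
    (h𝔑 : 𝔑 = (blocks ends d r s ρ₀).filter (hasY ends d ρ₀)) :
    ((∑ T ∈ 𝔉.powerset, ∑ S ∈ 𝔑.powerset.filter (fun S => S ≠ ∅ ∧ S ≠ 𝔑),
        sigma ends (assignX ends (T ∪ S, ∅) ρ₀) p q *
          sigma ends (assignX ends (T ∪ S, ∅) ρ₀) r s) +
      (∑ T ∈ 𝔉.powerset, ∑ S ∈ 𝔑.powerset.filter (fun S => S ≠ ∅ ∧ S ≠ 𝔑),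
        sigma ends (assignX ends (T ∪ S, ∅) (flipOp ends d r s ρ₀)) p q *
          sigma ends (assignX ends (T ∪ S, ∅) (flipOp ends d r s ρ₀)) r s)) +
    (∑ D ∈ (univ.filter (fun e => d ∈ ends e)).powerset.filter
        (fun D => D ≠ ∅ ∧ D ≠ univ.filter (fun e => d ∈ ends e)),
      ((∑ T ∈ 𝔉.powerset, sigma ends (assignX ends (T, ∅) (flipF D ρ₀)) p q *
          sigma ends (assignX ends (T, ∅) (flipF D ρ₀)) r s) +
        (∑ T ∈ 𝔉.powerset,
          sigma ends (assignX ends (T, ∅) (flipF D (flipOp ends d r s ρ₀))) p q *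
            sigma ends (assignX ends (T, ∅) (flipF D (flipOp ends d r s ρ₀))) r s))) ≤ 0 := by
  have hE := EX_add_EX_eq hnp hr hs hT hloop hrs hρ₀ hst h𝔉 h𝔑 (p := p) (q := q)
  have hYW := HY_le_HW hnp hpd hqd hr hs hT hloop hρ₀ hst h𝔉 h𝔑
  -- the dirty one-sided part
  have hK : (∑ D ∈ (univ.filter (fun e => d ∈ ends e)).powerset.filter
        (fun D => D ≠ ∅ ∧ D ≠ univ.filter (fun e => d ∈ ends e)),
      ((∑ T ∈ 𝔉.powerset, sigma ends (assignX ends (T, ∅) (flipF D ρ₀)) p q *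
          sigma ends (assignX ends (T, ∅) (flipF D ρ₀)) r s) +
        (∑ T ∈ 𝔉.powerset,
          sigma ends (assignX ends (T, ∅) (flipF D (flipOp ends d r s ρ₀))) p q *
            sigma ends (assignX ends (T, ∅) (flipF D (flipOp ends d r s ρ₀))) r s))) ≤
      (∑ D ∈ (univ.filter (fun e => d ∈ ends e)).powerset.filter
        (fun D => D ≠ ∅ ∧ D ≠ univ.filter (fun e => d ∈ ends e)),
        (if Conn ends (assignX ends (𝔉, ∅) (flipF D ρ₀)) r s then (1 : ℤ) else 0)) *
      ((∑ T ∈ 𝔉.powerset.filter (fun T => T ∩ 𝔉.filter (LinksIn ends ρ₀ r s) = ∅),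
          ((if Conn ends (assignX ends (T ∪ ∅, ∅) ρ₀) p q then (1 : ℤ) else 0) +
            (if Conn ends (assignX ends (T ∪ ∅, ∅) (flipOp ends d r s ρ₀)) p q
              then 1 else 0))) -
        (∑ T ∈ 𝔉.powerset.filter (fun T => 𝔉.filter (LinksIn ends ρ₀ r s) ⊆ T),
          ((if Conn ends (assignX ends (T ∪ 𝔑, ∅) ρ₀) p q then (1 : ℤ) else 0) +
            (if Conn ends (assignX ends (T ∪ 𝔑, ∅) (flipOp ends d r s ρ₀)) p q
              then 1 else 0)))) := by
    rw [Finset.sum_mul]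
    refine Finset.sum_le_sum (fun D hD => ?_)
    obtain ⟨hDp, _, hDA⟩ := Finset.mem_filter.1 hD
    exact K_add_K_le hnp hpd hqd hr hs hT hloop hrs hrs' hρ₀ hst (Finset.mem_powerset.1 hDp) hDA
      h𝔉 h𝔑 rfl (hYW ∅ (Finset.empty_subset _))
  have hquad := quad_two_ex_hd_nonpos_powerset 𝔑
    (ℓ := fun S => if Conn ends (assignX ends (𝔉 ∪ (𝔑 \ S), ∅) ρ₀) r s then (1 : ℤ) else 0)
    (HY := fun S => ∑ T ∈ 𝔉.powerset.filter (fun T => T ∩ 𝔉.filter (LinksIn ends ρ₀ r s) = ∅),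
      ((if Conn ends (assignX ends (T ∪ S, ∅) ρ₀) p q then (1 : ℤ) else 0) +
        (if Conn ends (assignX ends (T ∪ S, ∅) (flipOp ends d r s ρ₀)) p q then 1 else 0)))
    (HW := fun S => ∑ T ∈ 𝔉.powerset.filter (fun T => 𝔉.filter (LinksIn ends ρ₀ r s) ⊆ T),
      ((if Conn ends (assignX ends (T ∪ S, ∅) ρ₀) p q then (1 : ℤ) else 0) +
        (if Conn ends (assignX ends (T ∪ S, ∅) (flipOp ends d r s ρ₀)) p q then 1 else 0)))
    (link_mono hnp hpd hqd hr hs hT hρ₀ hst h𝔉 h𝔑) (fun S => by split_ifs <;> norm_num)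
    (fun S => by split_ifs <;> norm_num) (link_empty hnp hr hs hT hrs hrs' hρ₀ hst h𝔉 h𝔑)
    (HW_mono hnp hpd hqd hr hs hT hloop hρ₀ hst h𝔉 h𝔑) hYW
    (Finset.sum_nonneg (fun D _ => by split_ifs <;> norm_num))
    (fun _ hS => two_le_sum_linkK hnp hr hs hT hloop hrs hrs' hρ₀ hst h𝔉 h𝔑 hS)
  beta_reduce at hquad
  linarith [hE, hK, hquad]

/-- **THEOREM 2EXHD-NP.**  On the class `{NoPocketAt d, T-free, no loop at d, no r–s edge}` the
sharpened crux `2·exSum + hdSum ≤ 0` holds. -/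
theorem two_ex_add_hd_nonpos_of_noPocket {p q r s d : V} (hnp : NoPocketAt ends d r s)
    (hpd : p ≠ d) (hqd : q ≠ d) (hr : d ≠ r) (hs : d ≠ s) (hT : Tset ends d r s = ∅)
    (hloop : ∀ e, ends e ≠ s(d, d)) (hrs : ∀ e, ends e ≠ s(r, s)) :
    2 * exSum ends p q r s d + hdSum ends p q r s d ≤ 0 := by
  by_cases hrs' : r = s
  · subst hrs'
    have h1 : exSum ends p q r r d = 0 := by
      unfold exSum
      refine Finset.sum_eq_zero (fun ω _ => ?_)
      rw [sigma_self, mul_zero]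
      split_ifs <;> rfl
    have h2 : hdSum ends p q r r d = 0 := by
      unfold hdSum
      refine Finset.sum_eq_zero (fun ω _ => ?_)
      rw [sigma_self, mul_zero]
      split_ifs <;> rfl
    rw [h1, h2]
    norm_num
  rw [exSum_eq_sum_repD hnp hpd hqd hr hs, hdSum_eq_sum_repD hnp hpd hqd hr hs,
    sum_repD_eq_sum_sameType_powerset hT, sum_repD_eq_sum_sameType_powerset hT]
  have hex : ∀ ρ₀ ∈ (RepD ends p q r s d).filter (fun ρ => ∀ e, d ∈ ends e → ρ e = true),
      ∑ D ∈ (univ.filter (fun e => d ∈ ends e)).powerset, ∑ x ∈ L4 ends d r s (flipF D ρ₀),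
        (if d ∈ K2 ends r s (assignX ends x (flipF D ρ₀)) ∧
            d ∈ M2 ends r s (assignX ends x (flipF D ρ₀)) then
          sigma ends (assignX ends x (flipF D ρ₀)) p q *
            sigma ends (assignX ends x (flipF D ρ₀)) r s
        else 0) =
      ∑ T ∈ ((blocks ends d r s ρ₀).filter (fun C => ¬ hasY ends d ρ₀ C)).powerset,
        ∑ S ∈ ((blocks ends d r s ρ₀).filter (hasY ends d ρ₀)).powerset.filter
          (fun S => S ≠ ∅ ∧ S ≠ (blocks ends d r s ρ₀).filter (hasY ends d ρ₀)),
        sigma ends (assignX ends (T ∪ S, ∅) ρ₀) p q *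
          sigma ends (assignX ends (T ∪ S, ∅) ρ₀) r s := by
    intro ρ₀ hρ₀
    obtain ⟨hρ, hst⟩ := Finset.mem_filter.1 hρ₀
    exact sum_ex_sameType_all hnp hr hs hT hloop hρ hst rfl rfl
  have hhd : ∀ ρ₀ ∈ (RepD ends p q r s d).filter (fun ρ => ∀ e, d ∈ ends e → ρ e = true),
      ∑ D ∈ (univ.filter (fun e => d ∈ ends e)).powerset,
        (if hasDead ends d r s (flipF D ρ₀) ∧ hasSource ends d r s (flipF D ρ₀) then
          ∑ x ∈ L4 ends d r s (flipF D ρ₀),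
            sigma ends (assignX ends x (flipF D ρ₀)) p q *
              sigma ends (assignX ends x (flipF D ρ₀)) r s
        else 0) =
      ∑ D ∈ (univ.filter (fun e => d ∈ ends e)).powerset.filter
          (fun D => D ≠ ∅ ∧ D ≠ univ.filter (fun e => d ∈ ends e)),
        ((∑ T ∈ ((blocks ends d r s ρ₀).filter (fun C => ¬ hasY ends d ρ₀ C)).powerset,
            sigma ends (assignX ends (T, ∅) (flipF D ρ₀)) p q *
              sigma ends (assignX ends (T, ∅) (flipF D ρ₀)) r s) +
          (∑ T ∈ ((blocks ends d r s ρ₀).filter (fun C => ¬ hasY ends d ρ₀ C)).powerset,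
            sigma ends (assignX ends (T, ∅) (flipF D (flipOp ends d r s ρ₀))) p q *
              sigma ends (assignX ends (T, ∅) (flipF D (flipOp ends d r s ρ₀))) r s)) := by
    intro ρ₀ hρ₀
    obtain ⟨hρ, hst⟩ := Finset.mem_filter.1 hρ₀
    exact sum_hd_sameType_eq hnp hr hs hT hloop hrs hρ hst rfl rfl
  rw [Finset.sum_congr rfl hex, Finset.sum_congr rfl hhd]
  -- the doubling of the doubly-reached part by the outside flip
  have hdouble : ∑ ρ₀ ∈ (RepD ends p q r s d).filter (fun ρ => ∀ e, d ∈ ends e → ρ e = true),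
      ∑ T ∈ ((blocks ends d r s ρ₀).filter (fun C => ¬ hasY ends d ρ₀ C)).powerset,
        ∑ S ∈ ((blocks ends d r s ρ₀).filter (hasY ends d ρ₀)).powerset.filter
          (fun S => S ≠ ∅ ∧ S ≠ (blocks ends d r s ρ₀).filter (hasY ends d ρ₀)),
        sigma ends (assignX ends (T ∪ S, ∅) ρ₀) p q *
          sigma ends (assignX ends (T ∪ S, ∅) ρ₀) r s =
      ∑ ρ₀ ∈ (RepD ends p q r s d).filter (fun ρ => ∀ e, d ∈ ends e → ρ e = true),
      ∑ T ∈ ((blocks ends d r s ρ₀).filter (fun C => ¬ hasY ends d ρ₀ C)).powerset,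
        ∑ S ∈ ((blocks ends d r s ρ₀).filter (hasY ends d ρ₀)).powerset.filter
          (fun S => S ≠ ∅ ∧ S ≠ (blocks ends d r s ρ₀).filter (hasY ends d ρ₀)),
        sigma ends (assignX ends (T ∪ S, ∅) (flipOp ends d r s ρ₀)) p q *
          sigma ends (assignX ends (T ∪ S, ∅) (flipOp ends d r s ρ₀)) r s := by
    refine Finset.sum_nbij' (flipOp ends d r s) (flipOp ends d r s)
      (fun ρ hρ => flipOp_sameType hnp hr hs hT hloop hρ)
      (fun ρ hρ => flipOp_sameType hnp hr hs hT hloop hρ)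
      (fun ρ _ => flipOp_flipOp hr hs ρ) (fun ρ _ => flipOp_flipOp hr hs ρ) (fun ρ _ => ?_)
    rw [filter_free_flipOp hr hs, filter_joined_flipOp hr hs, flipOp_flipOp hr hs]
  have hle : ∑ ρ₀ ∈ (RepD ends p q r s d).filter (fun ρ => ∀ e, d ∈ ends e → ρ e = true),
      (((∑ T ∈ ((blocks ends d r s ρ₀).filter (fun C => ¬ hasY ends d ρ₀ C)).powerset,
          ∑ S ∈ ((blocks ends d r s ρ₀).filter (hasY ends d ρ₀)).powerset.filter
            (fun S => S ≠ ∅ ∧ S ≠ (blocks ends d r s ρ₀).filter (hasY ends d ρ₀)),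
          sigma ends (assignX ends (T ∪ S, ∅) ρ₀) p q *
            sigma ends (assignX ends (T ∪ S, ∅) ρ₀) r s) +
        (∑ T ∈ ((blocks ends d r s ρ₀).filter (fun C => ¬ hasY ends d ρ₀ C)).powerset,
          ∑ S ∈ ((blocks ends d r s ρ₀).filter (hasY ends d ρ₀)).powerset.filter
            (fun S => S ≠ ∅ ∧ S ≠ (blocks ends d r s ρ₀).filter (hasY ends d ρ₀)),
          sigma ends (assignX ends (T ∪ S, ∅) (flipOp ends d r s ρ₀)) p q *
            sigma ends (assignX ends (T ∪ S, ∅) (flipOp ends d r s ρ₀)) r s)) +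
      (∑ D ∈ (univ.filter (fun e => d ∈ ends e)).powerset.filter
          (fun D => D ≠ ∅ ∧ D ≠ univ.filter (fun e => d ∈ ends e)),
        ((∑ T ∈ ((blocks ends d r s ρ₀).filter (fun C => ¬ hasY ends d ρ₀ C)).powerset,
            sigma ends (assignX ends (T, ∅) (flipF D ρ₀)) p q *
              sigma ends (assignX ends (T, ∅) (flipF D ρ₀)) r s) +
          (∑ T ∈ ((blocks ends d r s ρ₀).filter (fun C => ¬ hasY ends d ρ₀ C)).powerset,
            sigma ends (assignX ends (T, ∅) (flipF D (flipOp ends d r s ρ₀))) p q *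
              sigma ends (assignX ends (T, ∅) (flipF D (flipOp ends d r s ρ₀))) r s)))) ≤ 0 := by
    refine Finset.sum_nonpos (fun ρ₀ hρ₀ => ?_)
    obtain ⟨hρ, hst⟩ := Finset.mem_filter.1 hρ₀
    exact unit_two_ex_hd_nonpos hnp hpd hqd hr hs hT hloop hrs hrs' hρ hst rfl rfl
  rw [Finset.sum_add_distrib, Finset.sum_add_distrib, ← hdouble] at hle
  linarith

/-- **Corollaries on the class** (`M9TwoExHd`): ⟦EXHD⟧ `exSum + hdSum ≤ 0` when `exSum ≥ 0`, the
`3/2`-form `3·exSum + 2·kOnlySum ≤ 0`, and `dSignSum ≤ 0`. -/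
theorem dSignSum_nonpos_of_noPocket_two_ex_hd {p q r s d : V} (hnp : NoPocketAt ends d r s)
    (hpd : p ≠ d) (hqd : q ≠ d) (hr : d ≠ r) (hs : d ≠ s) (hT : Tset ends d r s = ∅)
    (hloop : ∀ e, ends e ≠ s(d, d)) (hrs : ∀ e, ends e ≠ s(r, s)) :
    dSignSum ends p q r s d ≤ 0 :=
  dSignSum_nonpos_of_two_ex_add_hd hr hs
    (two_ex_add_hd_nonpos_of_noPocket hnp hpd hqd hr hs hT hloop hrs)

end TwoEXHD

end NoPocket

end Summit.Ventures.PercRepro2
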